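import Summits.ResolutionOfSingularities.ResolutionOfSingularities.Theorems.HilbertSamuelEliminationCampaignW42TertiaryInStratum
import Literature.AlgebraicGeometry.Resolution.AlterationsNormalFormBlowupParts
import Literature.AlgebraicGeometry.Resolution.StalkSpecializesLocalization
import Literature.AlgebraicGeometry.Resolution.StalkIdealGenerization
import Mathlib.Topology.Sober
import HarnessLib

/-!
# [OURS · L1 W4.2] «Y_{j,i} is the label-j part»: the replayed strict transform in a resolution cycle of `S(X, ν)` IS
# the label-`j` part of the next `ν`-stratum (CJS p. 92 «Y_{0,i} = Y_i^{(0)}», in the tree's rendering, every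
# dimension) — the label calculus (`--supports stmt-ResolutionOfSingularities-17846`)

OURS (slot W4.2 of cell res-hironaka, LADDER-RESOLUTION rung L, D-0089; prover seat res-L1-s42-pv-2, gen 2); NOT
statements of H. Hironaka's manuscript [Hironaka2017]; nothing of the manuscript is used or asserted. AI review is
weaker than expert review. Pure PROOF file; no new definition.

The InStratum file (p482776) reduced hypothesis (H3) of the O2 ⇒ `ν`-modification bridge to REGULARITY of the
canonical centres, and isolated what is left of CJS p. 92 «Y_{0,i} = Y_i^{(0)}»: the cycle-ending centres `Y_n^{(j)}`
must be regular. CJS obtain this from the IDENTITY of the label-`j` part with the replayed (regular) last stage of the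
lower-dimensional resolution sequence. This file proves the SET-THEORETIC PROPAGATION of that identity along one
blow-up, for the tree's label calculus `Labelling.next` (a component of `Y_{n+1}` inherits the label of the component
of `Y_n` it dominates, else gets the new year):

* `exists_componentsIn_superset` — an irreducible subset of a closed set with finitely many components lies in one.
* `not_subset_image_support_of_isPermissible` — A PERMISSIBLE CENTRE SWALLOWS NO COMPONENT: for a closed immersion
  `φ : S → W` with `φ(S) ⊆ Y` closed and `D ⊆ S` permissible (CJS Def. 3.1 (2): `D_ξ` lies in no minimal prime of
  `𝒪_{S,ξ}`), no irreducible component of `Y` inside `φ(S)` lies inside `φ(V(D))` (generic point, Stacks 01J7: the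
  minimal primes of `𝒪_{S,ξ}` are the `𝔭_{ξ'}` of the generisations `ξ' ⤳ ξ`, tree
  `exists_specializes_comap_stalkSpecializes_eq`, `mem_support_iff_stalkIdeal_le_primeOfSpecializes`).
* `next_part_eq_strictTransformSet` — THE LABEL CALCULUS: along `π : Bl_C(W) → W` with `Y' ↦ Y` (`π(Y') ⊆ Y`, both
  closed, finitely many components upstairs, strict transforms of subsets of `Y` inside `Y'`), for a label
  `j ≠ year + 1` none of whose components lies inside `V(C)`:
  `(L.next Y C).part Y' j = closure π⁻¹(L.part Y j ∖ V(C))` — the label-`j` part upstairs IS the strict transform of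
  the label-`j` part. (`⊆`: a label-`j` component upstairs dominates a label-`j` component `Z'` downstairs, is not inside
  `π⁻¹V(C)` since `Z' ⊄ V(C)`, hence is the closure of its trace off the exceptional locus; `⊇`: the strict transform of
  a component `Z' ⊄ V(C)` with label `j` is irreducible, lies in a component `Z₁` of `Y'`, and `closure π(Z₁) = Z'` by
  maximality of `Z'`, so `Z₁` inherits the label `j`.)

The Cycles file (next) feeds this into the canonical sequence: with it, ALL canonical centres of `S(X, ν)` at an
isolated origin are regular, permissible and in the strata, for every admissible oracle — (H3) disappears.

## References

* V. Cossart, U. Jannsen, S. Saito, LNM 2270 (2020), Rem. 6.29 (1) pp. 91–92 ((6.5)–(6.7), «Y_{0,i} = Y_i^{(0)}»),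
  Def. 3.1 (2). [CossartJannsenSaito2020]
* The Stacks Project, Tag 01J7 (points of `Spec 𝒪_{X,x}`). [StacksProject]
* U. Görtz, T. Wedhorn, *Algebraic Geometry I* (2nd ed. 2020), (13.19) p. 414, Prop. 13.91 (3). [GortzWedhorn2020]
-/

noncomputable section

set_option linter.dupNamespace false -- mandated namespace of this single-conjunct summit

open CategoryTheory AlgebraicGeometry TopologicalSpace Topology IsLocalRing

namespace Summit.ResolutionOfSingularities.ResolutionOfSingularities.Theorems

namespace CampaignW42

open Literature.AlgebraicGeometry.Resolution Literature.RingTheory.HilbertSamuel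

universe u

/-! ## Components: an irreducible subset lies in a component -/

/-- An irreducible subset of a closed set with finitely many irreducible components lies in one of them. [folklore] -/
theorem exists_componentsIn_superset {X : Type u} [TopologicalSpace X] {Y : Set X} (hY : IsClosed Y)
    (hfin : (componentsIn Y).Finite) {A : Set X} (hA : IsIrreducible A) (hAY : A ⊆ Y) :
    ∃ E ∈ componentsIn Y, A ⊆ E := by
  have hcov : A ⊆ ⋃₀ (hfin.toFinset : Set (Set X)) := by
    intro a ha
    obtain ⟨E, hE, haE⟩ := componentsIn.exists_mem (hAY ha)
    exact ⟨E, hfin.mem_toFinset.mpr hE, haE⟩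
  obtain ⟨E, hE, hAE⟩ := isIrreducible_iff_sUnion_isClosed.mp hA hfin.toFinset
    (fun E hE => componentsIn.isClosed hY (hfin.mem_toFinset.mp hE)) hcov
  exact ⟨E, hfin.mem_toFinset.mp hE, hAE⟩

/-! ## A permissible centre swallows no irreducible component -/

/-- **A PERMISSIBLE CENTRE SWALLOWS NO IRREDUCIBLE COMPONENT** (CJS Def. 3.1 (2): «`D` contains no irreducible component of
`X` containing `x`», rendered `∀ p ∈ minimalPrimes 𝒪_{S,ξ}, ¬ D_ξ ≤ p`), in the form used by the label calculus: for a
closed immersion `φ : S → W` with `φ(S) ⊆ Y`, `Y` closed, and `D ⊆ S` permissible, no irreducible component `Z'` of `Y`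
lying inside `φ(S)` lies inside `φ(V(D))`. At the generic point `ζ = φ(ξ)` of `Z'`: a minimal prime of `𝒪_{S,ξ}` is
`𝔭_{ξ'}` for a generisation `ξ' ⤳ ξ` (Stacks 01J7); `φ(ξ') ⤳ ζ` forces `closure {φ ξ'} ⊇ Z'`, hence `= Z'`
(maximality), so `ξ' ∈ V(D)` and `D_ξ ≤ 𝔭_{ξ'}` — contradiction.
[cite: CossartJannsenSaito2020, Def. 3.1 (2)] [cite: StacksProject, Tag 01J7] -/
theorem not_subset_image_support_of_isPermissible {S W : Scheme.{u}} (φ : S ⟶ W) [IsClosedImmersion φ]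
    {D : S.IdealSheafData} (hD : IdealSheafData.IsPermissible D) {Y : Set W} (hY : IsClosed Y)
    (hφY : Set.range φ.base ⊆ Y) {Z' : Set W} (hZ' : Z' ∈ componentsIn Y) :
    ¬ Z' ⊆ φ.base '' (D.support : Set S) := by
  intro hsub
  have hirr : IsIrreducible Z' := componentsIn.isIrreducible hZ'
  have hcl : IsClosed Z' := componentsIn.isClosed hY hZ'
  have hζ : IsGenericPoint hirr.genericPoint Z' := hirr.isGenericPoint_genericPoint hcl
  obtain ⟨ξ, hξD, hξ⟩ := hsub hζ.mem
  -- a minimal prime of `𝒪_{S,ξ}` and the generisation it comes from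
  obtain ⟨p, hp, -⟩ := Ideal.exists_minimalPrimes_le (I := (⊥ : Ideal (S.presheaf.stalk ξ)))
    (J := maximalIdeal (S.presheaf.stalk ξ)) bot_le
  haveI : p.IsPrime := hp.1.1
  obtain ⟨ξ', h, hp'⟩ := exists_specializes_comap_stalkSpecializes_eq ξ p
  -- `φ ξ' ⤳ ζ`, so `closure {φ ξ'} ⊇ Z'`, hence `⊆ Z'` by maximality, so `φ ξ' ∈ Z'`
  have h1 : φ.base ξ' ⤳ hirr.genericPoint := hξ ▸ h.map φ.base.hom.continuous
  have h2 : Z' ⊆ closure {φ.base ξ'} := by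
    rw [← hζ.def]
    exact closure_minimal (Set.singleton_subset_iff.mpr h1.mem_closure) isClosed_closure
  have h3 : closure {φ.base ξ'} ⊆ Y :=
    closure_minimal (Set.singleton_subset_iff.mpr (hφY ⟨ξ', rfl⟩)) hY
  have h4 : closure {φ.base ξ'} ⊆ Z' :=
    (mem_componentsIn_iff.mp hZ').2.2 _ h3 isIrreducible_singleton.closure h2
  have h5 : φ.base ξ' ∈ φ.base '' (D.support : Set S) := hsub (h4 (subset_closure rfl))
  obtain ⟨ξ'', hξ''D, heq⟩ := h5
  obtain rfl : ξ'' = ξ' := φ.isClosedEmbedding.injective heq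
  -- `D_ξ ≤ 𝔭_{ξ'} = p`: contradiction with permissibility at `ξ`
  have h6 : stalkIdeal D ξ ≤ primeOfSpecializes h :=
    (mem_support_iff_stalkIdeal_le_primeOfSpecializes h D).mp hξ''D
  have h7 : stalkIdeal D ξ ≤ p := by
    rw [hp']
    exact h6
  exact (hD ξ hξD).not_le_of_mem_minimalPrimes hp h7

/-! ## The label calculus along one blow-up -/

/-- The strict transform of an irreducible set not inside the centre is irreducible (the blow-up is an isomorphism
off the centre, GW Prop. 13.91 (3)). [cite: GortzWedhorn2020, Prop. 13.91 (3), (13.19) p. 414] -/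
theorem isIrreducible_strictTransformSet_of_not_subset {W : Scheme.{u}} (C : W.IdealSheafData) {Z : Set W}
    (hZ : IsIrreducible Z) (hZC : ¬ Z ⊆ (C.support : Set W)) :
    IsIrreducible (strictTransformSet (blowup.π C) (C.support : Set W) Z) := by
  haveI : IsIso (blowup.π C ∣_ ⟨(C.support : Set W)ᶜ, C.support.isClosed.isOpen_compl⟩) :=
    (blowup.isBlowup C).isIso_compl
  refine IsIrreducible.closure ?_
  have hne : (Z ∩ (C.support : Set W)ᶜ).Nonempty := by
    by_contra h
    rw [Set.not_nonempty_iff_eq_empty, ← Set.sdiff_eq, Set.sdiff_eq_empty] at h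
    exact hZC h
  have hirr : IsIrreducible (Z \ (C.support : Set W)) := by
    rw [Set.sdiff_eq]
    exact ⟨hne, isPreirreducible_inter_of_isOpen hZ.isPreirreducible C.support.isClosed.isOpen_compl⟩
  exact isIrreducible_preimage_of_isIso_morphismRestrict (blowup.π C)
    ⟨(C.support : Set W)ᶜ, C.support.isClosed.isOpen_compl⟩ hirr (Set.sdiff_subset_compl Z _)

/-- **THE LABEL CALCULUS ALONG ONE BLOW-UP — the label-`j` part upstairs is the strict transform of the label-`j`
part** (CJS Rem. 6.29 (1), (6.5)–(6.7): «`Y_{0,i}` is the strict transform of `Y_{0,i-1}` and, moreover,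
`Y_{0,i} = Y_i^{(0)}`», in the tree's rendering `Labelling.next`). Data: `π : Bl_C(W) → W`; closed `Y ⊆ W` and
`Y' ⊆ Bl_C(W)` with `π(Y') ⊆ Y`, finitely many components upstairs, and the strict transform of every subset of `Y`
inside `Y'` (for the `ν`-strata: `strictTransformSet_subset_hsStratum`); a label `j ≠ year + 1` NONE OF WHOSE
COMPONENTS LIES INSIDE `V(C)` (for a permissible centre inside the replayed subscheme:
`not_subset_image_support_of_isPermissible`). Then `(L.next Y C).part Y' j = closure π⁻¹(L.part Y j ∖ V(C))`.
[cite: CossartJannsenSaito2020, Rem. 6.29 (1)] [cite: GortzWedhorn2020, (13.19) p. 414, Prop. 13.91 (3)] -/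
theorem next_part_eq_strictTransformSet {W : Scheme.{u}} (C : W.IdealSheafData) (L : Labelling W) {Y : Set W}
    (hY : IsClosed Y) {Y' : Set ↥(blowup C)} (hY' : IsClosed Y') (hfin' : (componentsIn Y').Finite)
    (hπY' : (blowup.π C).base '' Y' ⊆ Y)
    (hST : ∀ T, T ⊆ Y → strictTransformSet (blowup.π C) (C.support : Set W) T ⊆ Y')
    {j : ℕ} (hj : j ≠ L.year + 1)
    (hjC : ∀ Z' ∈ componentsIn Y, L.label Z' = j → ¬ Z' ⊆ (C.support : Set W)) :
    (L.next Y C).part Y' j = strictTransformSet (blowup.π C) (C.support : Set W) (L.part Y j) := by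
  haveI : IsIso (blowup.π C ∣_ ⟨(C.support : Set W)ᶜ, C.support.isClosed.isOpen_compl⟩) :=
    (blowup.isBlowup C).isIso_compl
  have hEπ : IsClosed ((blowup.π C).base ⁻¹' (C.support : Set W)) :=
    C.support.isClosed.preimage (blowup.π C).continuous
  apply Set.Subset.antisymm
  · -- `⊆`: a label-`j` component upstairs is the closure of its trace off `π⁻¹ V(C)`
    intro y hy
    obtain ⟨Z, hZ, hlab, hyZ⟩ := ((L.next Y C).mem_part_iff Y' j y).mp hy
    by_cases hmem : closure (blowup.π C '' Z) ∈ componentsIn Y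
    · have hlabZ' : L.label (closure (blowup.π C '' Z)) = j := by
        rw [← L.next_label_of_mem C hmem]
        exact hlab
      have hZ'part : closure (blowup.π C '' Z) ⊆ L.part Y j := L.subset_part hmem hlabZ'
      have hne : (Z ∩ ((blowup.π C).base ⁻¹' (C.support : Set W))ᶜ).Nonempty := by
        by_contra h
        rw [Set.not_nonempty_iff_eq_empty, ← Set.sdiff_eq, Set.sdiff_eq_empty] at h
        have hsub : closure (blowup.π C '' Z) ⊆ (C.support : Set W) :=
          closure_minimal (Set.image_subset_iff.mpr h) C.support.isClosed
        exact hjC _ hmem hlabZ' hsub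
      have h1 : Z ⊆ closure (Z ∩ ((blowup.π C).base ⁻¹' (C.support : Set W))ᶜ) :=
        subset_closure_inter_of_isPreirreducible_of_isOpen (componentsIn.isIrreducible hZ).isPreirreducible
          hEπ.isOpen_compl hne
      have h2 : Z ∩ ((blowup.π C).base ⁻¹' (C.support : Set W))ᶜ ⊆
          (blowup.π C).base ⁻¹' (L.part Y j \ (C.support : Set W)) := by
        rintro z ⟨hzZ, hzE⟩
        exact ⟨hZ'part (subset_closure ⟨z, hzZ, rfl⟩), hzE⟩
      exact (h1.trans (closure_mono h2)) hyZ
    · exfalso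
      rw [L.next_label_of_not_mem C hmem] at hlab
      exact hj hlab.symm
  · -- `⊇`: the strict transform of a label-`j` component `Z' ⊄ V(C)` lies in a component `Z₁` of `Y'` dominating `Z'`
    refine closure_minimal ?_ ((L.next Y C).isClosed_part hY' hfin' j)
    rintro y ⟨hyT, hyE⟩
    obtain ⟨Z', hZ', hlab', hyZ'⟩ := (L.mem_part_iff Y j _).mp hyT
    have hZ'E : ¬ Z' ⊆ (C.support : Set W) := fun h => hyE (h hyZ')
    have hAirr : IsIrreducible (strictTransformSet (blowup.π C) (C.support : Set W) Z') :=
      isIrreducible_strictTransformSet_of_not_subset C (componentsIn.isIrreducible hZ') hZ'E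
    have hAY' : strictTransformSet (blowup.π C) (C.support : Set W) Z' ⊆ Y' := hST Z' (componentsIn.subset hZ')
    obtain ⟨Z₁, hZ₁, hAZ₁⟩ := exists_componentsIn_superset hY' hfin' hAirr hAY'
    -- `closure π(Z₁) = Z'`
    have hsub1 : closure (blowup.π C '' Z₁) ⊆ Y :=
      closure_minimal ((Set.image_mono (componentsIn.subset hZ₁)).trans hπY') hY
    have hirr1 : IsIrreducible (closure (blowup.π C '' Z₁)) :=
      ((componentsIn.isIrreducible hZ₁).image _ (blowup.π C).continuous.continuousOn).closure
    have hsub2 : Z' ⊆ closure (blowup.π C '' Z₁) := by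
      have hd : Z' ⊆ closure (Z' ∩ (C.support : Set W)ᶜ) :=
        subset_closure_inter_of_isPreirreducible_of_isOpen (componentsIn.isIrreducible hZ').isPreirreducible
          C.support.isClosed.isOpen_compl ⟨(blowup.π C).base y, hyZ', hyE⟩
      refine hd.trans (closure_mono ?_)
      rintro w ⟨hwZ', hwE⟩
      obtain ⟨x, hx⟩ :=
        exists_apply_eq_of_isIso_morphismRestrict (blowup.π C) ⟨(C.support : Set W)ᶜ, _⟩ hwE
      refine ⟨x, hAZ₁ (strictTransformSet.preimage_diff_subset (blowup.π C) (C.support : Set W) Z' ?_), hx⟩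
      show (blowup.π C).base x ∈ Z' \ (C.support : Set W)
      rw [show (blowup.π C).base x = w from hx]
      exact ⟨hwZ', hwE⟩
    have heq : closure (blowup.π C '' Z₁) = Z' :=
      Set.Subset.antisymm ((mem_componentsIn_iff.mp hZ').2.2 _ hsub1 hirr1 hsub2) hsub2
    have hmem : closure (blowup.π C '' Z₁) ∈ componentsIn Y := by
      rw [heq]
      exact hZ'
    have hlab1 : (L.next Y C).label Z₁ = j := by
      rw [L.next_label_of_mem C hmem, heq]
      exact hlab'
    exact (L.next Y C).subset_part hZ₁ hlab1
      (hAZ₁ (strictTransformSet.preimage_diff_subset (blowup.π C) (C.support : Set W) Z' ⟨hyZ', hyE⟩))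

end CampaignW42

end Summit.ResolutionOfSingularities.ResolutionOfSingularities.Theorems

end
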